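import Summits.QuantumFields.YangMills.Theorems.UnitScaleTiltProp7CovariantBlockPoincare
import Summits.QuantumFields.YangMills.Theorems.UnitScaleTiltProp7BondAvgIterCoercivity
import Summits.QuantumFields.YangMills.Theorems.UnitScaleTiltProp7CombMeanCentred
import Summits.QuantumFields.YangMills.Theorems.UnitScaleTiltProp7BondAvgIterOsc
import Summits.QuantumFields.YangMills.Theorems.UnitScaleTiltProp7IterLinStructureRec
import Literature.MathematicalPhysics.QuantumFieldTheory.Balaban1983to89.TorusGeometry
import HarnessLib

/-!
# Route `UnitScaleTilt`, crux K1 «MinimiserStabilityRegPr» (stmt-QuantumFields-19200), line «route-R» (`Lines/birth_routeR.lean` v2 5b75208179c6919a),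
# stub P `stub_relPoincareOpt` — linear flat core, step N6-B3∕N6-C of the P-lin-flat plan (CARD-19200-V3-g11): THE `(H¹)^*`-BOUND OF THE STRUCTURE
# THEOREM'S COARSE GAUGE FUNCTION, `‖Λ_k(Y)(y)‖² ≤ c₂·L^k·(interior gradient energy of Y on B^k(y))`, `c₂` INDEPENDENT OF `k` (d = 3)

Cell `ym3-torus` ∕ fleet seat `ym-ust-19200-p1` (gen 11, route-R lead).  The k-uniformity of route-R's P-constant lives here: per level,
`‖L^j·combMean(Q_jY)(z)‖ ≤ (d+2)L·√N·L·(√L)^j·√E_{j+1}(z)` (centring `Prop7CombMeanCentred` + tent `ℓ²`-closeness `Prop7BondAvgIterOsc` + the cube Poincaré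
inequality `Prop7CovariantCoercivity.block_poincare_comb` AT THE TRIVIAL BACKGROUND), `E_{j+1}(z)` the interior gradient energy of `Y` on the fine `(j+1)`-block
of `z`; the energies are monotone along the nesting `B^j(emb y) ⊂ B^{j+1}(y)`, and `Prop7IterLinStructureRec.norm_iterLambda_sub_le` sums the GEOMETRIC series
`Σ_{j<k} (√L)^j ≤ (√L)^k/(√L − 1)`.

WHAT IS PROVED (sorry-free, no definition; `Matrix (Fin N) (Fin N) ℂ`-valued fields, operator norm):
* §1 `sum_sq_sub_blockMean_le_grad` — cube Poincaré at `V = 1` on one fine block (mean subtracted, constant `N/4`, interior bonds), `sum_offsets_eq_sum_filter`,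
  `sum_interior_le_sum_filter` (offset chart ↦ `Site.proj` filter with the «both end-points in the block» indicator), `sum_filter_le_sum_filter_succ` (nesting).
* §2 **`norm_sq_bondAvgIter_sub_blockMean_le`**: for a level-`j` bond `b` inside `B(z)`, `‖Q_jY(b) − m_{dir b}(z)‖² ≤ N·(L^{j+1})²·L^{−jd}·E_{j+1}(z)`.
* §3 **`norm_nsmul_combMean_le_energy`** (per level, `d = 3`): `‖L^j·combMean(Q_jY)(z)‖ ≤ (d+2)L·(√N·L·(√L)^j)·√E_{j+1}(z)`; `energy_mono` (`E_j(emb y) ≤ E_{j+1}(y)`).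
* §4 **`norm_sq_iterLambda_le`** (`d = 3`): for every recursion family `Λ` of the structure theorem and every `k ≤ m + K`,
  `‖Λ_k(Y)(y)‖² ≤ ((d+2)L)²·N·L²·L^k/(√L − 1)²·E_k(y)`.

HONEST SCOPE.  Linear, flat, one block at a time; `E_k(y)` is written as an explicit indicator sum (no definition).  Nothing of Bałaban's analysis is asserted.

References: T. Bałaban, CMP 95 (1984) 17–40 [Balaban1984PropagatorsI] ((1.18)–(1.20) pp.19–20); J. Stat. Phys./CMP 89 (1983) 571–597
[Balaban1983RegularityDecay] ((2.27) p.580); CMP 98 (1985) 17–51 [Balaban1985Averaging] ((62) p.28); CMP 102 (1985) 277–309 [Balaban1985Variational] (Prop. 7 p.299).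
-/

noncomputable section

open scoped BigOperators Matrix.Norms.L2Operator Matrix

namespace Summit.QuantumFields.YangMills.Theorems.Prop7IterLambdaBound

open Literature.MathematicalPhysics.QuantumFieldTheory.Balaban1983to89
open Finset T4Continuum BlockAveraging BlockAveragingEMLLinearised LatticeFieldCalculus B1RG242Torus
open B5Leaf237C0Torus (bsite bsite_stepUp proj_bsite)
open Beta.CoordCubePoincare (stepUp)
open B7Prop1Explicit (U1 plaqWord)
open B7Eq78Linearization (conjR)
open B8Ineq132 (one_conjR)
open B10Eq27TorusAxialLog (holT holT_one)
open Summit.QuantumFields.YangMills.Theorems.Prop7CovariantCoercivity (block_poincare_comb)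
open Summit.QuantumFields.YangMills.Theorems.Prop7FlatCoercivity (sum_fibre_eq_sum_offsets sum_fibre_succ sitesPerDir_zero_eq_pow_mul)
open Summit.QuantumFields.YangMills.Theorems.Prop7CombMeanCentred (norm_combMean_le_osc)
open Summit.QuantumFields.YangMills.Theorems.Prop7BondAvgIterOsc (norm_sq_bondAvgIter_sub_const_le)
open Summit.QuantumFields.YangMills.Theorems.Prop7IterLinStructureRec (norm_iterLambda_sub_le geom_sum_sqrt_le)

variable {P : Params} {N : ℕ} [NeZero N]

/-! ## §1 One fine block: the cube Poincaré inequality at the trivial background, in the offset chart and in the `Site.proj` filter -/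

/-- **CUBE POINCARÉ AT `V = 1`, MEAN SUBTRACTED**: on the fine block `B^e(z)` (side `n + 1 = L^e`), for every `M_N(ℂ)`-valued bond field `X` and direction `μ`,
`Σ_r ‖X(⟨x_r, μ⟩) − m‖² ≤ (N/4)(L^e)²·Σ_ν Σ_{r, r+e_ν ∈ B} ‖X(⟨x_r + e_ν, μ⟩) − X(⟨x_r, μ⟩)‖²`, `m` the block mean (`block_poincare_comb` with the trivial background:
no defect term, and the mean term vanishes). [cite: Balaban1983RegularityDecay, (2.27) p.580] -/
theorem sum_sq_sub_blockMean_le_grad {e n : ℕ} (hn : n + 1 = P.L ^ e) (z : Site P e) (X : PBond P 0 → Matrix (Fin N) (Fin N) ℂ) (μ : Fin P.d) :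
    ∑ r : Fin P.d → Fin (n + 1), ‖X ⟨bsite P 0 e hn z r, μ⟩ - ((((n : ℝ) + 1) ^ P.d)⁻¹ • ∑ r' : Fin P.d → Fin (n + 1), X ⟨bsite P 0 e hn z r', μ⟩)‖ ^ 2
      ≤ (N / 4) * ((n : ℝ) + 1) ^ 2 * ∑ ν : Fin P.d, ∑ r ∈ univ.filter (fun r : Fin P.d → Fin (n + 1) => r ν ≠ Fin.last n),
            ‖X ⟨(bsite P 0 e hn z r).shift ν, μ⟩ - X ⟨bsite P 0 e hn z r, μ⟩‖ ^ 2 := by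
  set m : Matrix (Fin N) (Fin N) ℂ := (((n : ℝ) + 1) ^ P.d)⁻¹ • ∑ r' : Fin P.d → Fin (n + 1), X ⟨bsite P 0 e hn z r', μ⟩ with hm
  have hV : ∀ b : PBond P 0, (fun _ : PBond P 0 => (1 : (Matrix (Fin N) (Fin N) ℂ)ˣ)) b ∈ U1 (Matrix (Fin N) (Fin N) ℂ) :=
    fun _ => (U1 _).one_mem
  have hplaq : ∀ (x : Site P 0) (κ μ' : Fin P.d), κ ≠ μ' →
      ‖((holT (fun _ : PBond P 0 => (1 : (Matrix (Fin N) (Fin N) ℂ)ˣ)) x (plaqWord κ μ') : (Matrix (Fin N) (Fin N) ℂ)ˣ) : Matrix (Fin N) (Fin N) ℂ) - 1‖ ≤ 0 := by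
    intro x κ μ' _
    rw [holT_one]
    simp
  have h := block_poincare_comb (P := P) (i := 0) (i' := e) (e := e) hV le_rfl hplaq hn z (fun x => X ⟨x, μ⟩ - m)
  -- the mean term vanishes
  have hmean : ∑ r : Fin P.d → Fin (n + 1), (X ⟨bsite P 0 e hn z r, μ⟩ - m) = 0 := by
    rw [Finset.sum_sub_distrib, Finset.sum_const, Finset.card_univ, Fintype.card_fun, Fintype.card_fin, Fintype.card_fin, hm,
      ← Nat.cast_smul_eq_nsmul ℝ, smul_smul]
    have : (((n + 1) ^ P.d : ℕ) : ℝ) * (((n : ℝ) + 1) ^ P.d)⁻¹ = 1 := by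
      push_cast
      exact mul_inv_cancel₀ (by positivity)
    rw [this, one_smul, sub_self]
  simp only [one_conjR, holT_one, mul_zero, sub_sub_sub_cancel_right] at h
  rw [hmean, norm_zero] at h
  have h0 : (N : ℝ) * (((n : ℝ) + 1) ^ P.d)⁻¹ * (0 : ℝ) ^ 2 = 0 := by simp
  linarith [h, h0]

/-- The offset chart and the `Site.proj` filter describe the same block: `Σ_r G(x_r) = Σ_{x : proj x = z} G(x)`. [folklore] -/
theorem sum_offsets_eq_sum_filter {e n : ℕ} (h : P.sitesPerDir 0 = P.L ^ e * P.sitesPerDir e) (hn : n + 1 = P.L ^ e) (z : Site P e)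
    {M : Type*} [AddCommMonoid M] (G : Site P 0 → M) :
    ∑ r : Fin P.d → Fin (n + 1), G (bsite P 0 e hn z r) = ∑ x ∈ univ.filter (fun x : Site P 0 => Site.proj e e x = z), G x := by
  rw [sum_fibre_eq_sum_offsets h z G]
  exact (Equiv.piCongrRight fun _ : Fin P.d => finCongr hn).sum_comp (fun r : Fin P.d → Fin (P.L ^ e) => G (Site.fibreSite 0 e z r))

/-- **INTERIOR OFFSET PAIRS ARE BLOCK-INTERNAL BOND PAIRS**: for nonnegative `g`,
`Σ_ν Σ_{r, r_ν ≠ last} g(x_r + e_ν, x_r) ≤ Σ_ν Σ_{x : proj x = z} [proj (x + e_ν) = z]·g(x + e_ν, x)`. [folklore] -/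
theorem sum_interior_le_sum_filter {e n : ℕ} (h : P.sitesPerDir 0 = P.L ^ e * P.sitesPerDir e) (hn : n + 1 = P.L ^ e) (z : Site P e)
    (g : Site P 0 → Site P 0 → ℝ) (hg : ∀ x x', 0 ≤ g x x') :
    ∑ ν : Fin P.d, ∑ r ∈ univ.filter (fun r : Fin P.d → Fin (n + 1) => r ν ≠ Fin.last n), g ((bsite P 0 e hn z r).shift ν) (bsite P 0 e hn z r)
      ≤ ∑ ν : Fin P.d, ∑ x ∈ univ.filter (fun x : Site P 0 => Site.proj e e x = z),
          (if Site.proj e e (x.shift ν) = z then g (x.shift ν) x else 0) := by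
  refine Finset.sum_le_sum fun ν _ => ?_
  rw [← sum_offsets_eq_sum_filter h hn z]
  calc ∑ r ∈ univ.filter (fun r : Fin P.d → Fin (n + 1) => r ν ≠ Fin.last n), g ((bsite P 0 e hn z r).shift ν) (bsite P 0 e hn z r)
      = ∑ r ∈ univ.filter (fun r : Fin P.d → Fin (n + 1) => r ν ≠ Fin.last n),
          (if Site.proj e e ((bsite P 0 e hn z r).shift ν) = z then g ((bsite P 0 e hn z r).shift ν) (bsite P 0 e hn z r) else 0) := by
        refine Finset.sum_congr rfl fun r hr => ?_
        have hr' : r ν ≠ Fin.last n := (Finset.mem_filter.mp hr).2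
        have hin : Site.proj e e ((bsite P 0 e hn z r).shift ν) = z := by
          rw [← bsite_stepUp P hn z r ν hr', proj_bsite P h hn]
        rw [if_pos hin]
    _ ≤ ∑ r : Fin P.d → Fin (n + 1),
          (if Site.proj e e ((bsite P 0 e hn z r).shift ν) = z then g ((bsite P 0 e hn z r).shift ν) (bsite P 0 e hn z r) else 0) := by
        refine Finset.sum_le_sum_of_subset_of_nonneg (Finset.filter_subset _ _) fun r _ _ => ?_
        split_ifs
        · exact hg _ _
        · exact le_rfl

/-- **NESTING**: a sum of nonnegative terms over the `j`-block of a site `y` of `B(z)` is at most the sum over the `(j+1)`-block of `z`. [folklore] -/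
theorem sum_filter_le_sum_filter_succ {j : ℕ} (h : P.sitesPerDir 0 = P.L ^ j * P.sitesPerDir j)
    (h' : P.sitesPerDir j = P.L ^ 1 * P.sitesPerDir (j + 1)) (z : Site P (j + 1)) {y : Site P j} (hy : blockOf y = z)
    (G : Site P 0 → ℝ) (hG : ∀ x, 0 ≤ G x) :
    ∑ x ∈ univ.filter (fun x : Site P 0 => Site.proj j j x = y), G x
      ≤ ∑ x ∈ univ.filter (fun x : Site P 0 => Site.proj (j + 1) (j + 1) x = z), G x := by
  rw [← sum_fibre_succ h h' z G]
  have hy' : y ∈ univ.filter (fun y' : Site P j => blockOf y' = z) := by simp [hy]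
  exact Finset.single_le_sum (f := fun y' => ∑ x ∈ univ.filter (fun x : Site P 0 => Site.proj j j x = y'), G x)
    (fun y' _ => Finset.sum_nonneg fun x _ => hG x) hy'

/-- Membership version of the nesting: `proj_j x = y`, `y ∈ B(z)` ⇒ `proj_{j+1} x = z`. [folklore] -/
theorem proj_succ_of_proj {j : ℕ} (h : P.sitesPerDir 0 = P.L ^ j * P.sitesPerDir j)
    (h' : P.sitesPerDir j = P.L ^ 1 * P.sitesPerDir (j + 1)) {x : Site P 0} {y : Site P j} (hx : Site.proj j j x = y) :
    Site.proj (j + 1) (j + 1) x = blockOf y := by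
  rw [← hx, ← Site.proj_one_eq_blockOf, Site.proj_comp h h']


/-! ## §2 The `j`-fold tent average at a bond of `B(z)` is `ℓ²`-close to the block mean: gradient form -/

/-- `|T^{(j)}| = L·|T^{(j+1)}|` per direction in the standing range. [folklore] -/
theorem sitesPerDir_succ_of_le {j : ℕ} (hj : j + 1 ≤ P.m + P.K) : P.sitesPerDir j = P.L ^ 1 * P.sitesPerDir (j + 1) := by
  rw [sitesPerDir_eq_succ P j, stepExp_of_lt P hj]

/-- `runSite y μ 1 = y + e_μ` (the far end of a coarse bond). [folklore] -/
theorem runSite_one_eq_tgt {j : ℕ} (c : PBond P j) : runSite c.src c.dir 1 = c.tgt := by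
  show runSite c.src c.dir 1 = c.src.shift c.dir
  simp [runSite, Site.shift]

/-- **`‖(Q_jY)(c) − m_μ(z)‖² ≤ N·(L^{j+1})²·L^{−jd}·E^μ_{j+1}(z)`** for a level-`j` bond `c` with both end-points in `B(z)`: `m_μ(z)` the mean of `Y_μ` over the fine
`(j+1)`-block of `z`, `E^μ_{j+1}(z)` the interior gradient energy of `Y_μ` there (tent `ℓ²`-closeness `Prop7BondAvgIterOsc` on the two `j`-blocks ⊂ `B^{j+1}(z)`, then
the cube Poincaré inequality of §1). [cite: Balaban1984PropagatorsI, (1.18) p.20; Balaban1983RegularityDecay, (2.27) p.580] -/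
theorem norm_sq_bondAvgIter_sub_blockMean_le {j n : ℕ} (hj : j + 1 ≤ P.m + P.K) (hn : n + 1 = P.L ^ (j + 1)) (z : Site P (j + 1))
    (Y : PBond P 0 → Matrix (Fin N) (Fin N) ℂ) (c : PBond P j) (hsrc : blockOf c.src = z) (htgt : blockOf c.tgt = z) :
    ‖bondAvgIter j Y c - (((n : ℝ) + 1) ^ P.d)⁻¹ • ∑ r' : Fin P.d → Fin (n + 1), Y ⟨bsite P 0 (j + 1) hn z r', c.dir⟩‖ ^ 2
      ≤ N * ((n : ℝ) + 1) ^ 2 * (((P.L : ℝ) ^ j) ^ P.d)⁻¹ *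
          ∑ ν : Fin P.d, ∑ x ∈ univ.filter (fun x : Site P 0 => Site.proj (j + 1) (j + 1) x = z),
            (if Site.proj (j + 1) (j + 1) (x.shift ν) = z then ‖Y ⟨x.shift ν, c.dir⟩ - Y ⟨x, c.dir⟩‖ ^ 2 else 0) := by
  have hj0 : j ≤ P.m + P.K := Nat.le_of_succ_le hj
  have h0j : P.sitesPerDir 0 = P.L ^ j * P.sitesPerDir j := sitesPerDir_zero_eq_pow_mul hj0
  have h0 : P.sitesPerDir 0 = P.L ^ (j + 1) * P.sitesPerDir (j + 1) := sitesPerDir_zero_eq_pow_mul hj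
  have h' : P.sitesPerDir j = P.L ^ 1 * P.sitesPerDir (j + 1) := sitesPerDir_succ_of_le hj
  set m : Matrix (Fin N) (Fin N) ℂ := (((n : ℝ) + 1) ^ P.d)⁻¹ • ∑ r' : Fin P.d → Fin (n + 1), Y ⟨bsite P 0 (j + 1) hn z r', c.dir⟩ with hm
  set S : ℝ := ∑ x ∈ univ.filter (fun x : Site P 0 => Site.proj (j + 1) (j + 1) x = z), ‖Y ⟨x, c.dir⟩ - m‖ ^ 2 with hS
  set E : ℝ := ∑ ν : Fin P.d, ∑ x ∈ univ.filter (fun x : Site P 0 => Site.proj (j + 1) (j + 1) x = z),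
      (if Site.proj (j + 1) (j + 1) (x.shift ν) = z then ‖Y ⟨x.shift ν, c.dir⟩ - Y ⟨x, c.dir⟩‖ ^ 2 else 0) with hE
  -- the two `j`-blocks sit inside `B^{j+1}(z)`
  have hA : ∑ r : Fin P.d → Fin (P.L ^ j), ‖Y ⟨Site.fibreSite 0 j c.src r, c.dir⟩ - m‖ ^ 2 ≤ S := by
    rw [← sum_fibre_eq_sum_offsets h0j c.src (fun x => ‖Y ⟨x, c.dir⟩ - m‖ ^ 2)]
    exact sum_filter_le_sum_filter_succ h0j h' z hsrc _ fun x => sq_nonneg _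
  have hB : ∑ r : Fin P.d → Fin (P.L ^ j), ‖Y ⟨Site.fibreSite 0 j (runSite c.src c.dir 1) r, c.dir⟩ - m‖ ^ 2 ≤ S := by
    rw [runSite_one_eq_tgt, ← sum_fibre_eq_sum_offsets h0j c.tgt (fun x => ‖Y ⟨x, c.dir⟩ - m‖ ^ 2)]
    exact sum_filter_le_sum_filter_succ h0j h' z htgt _ fun x => sq_nonneg _
  -- Poincaré on the `(j+1)`-block
  have hP : S ≤ (N / 4) * ((n : ℝ) + 1) ^ 2 * E := by
    rw [hS, ← sum_offsets_eq_sum_filter h0 hn z (fun x => ‖Y ⟨x, c.dir⟩ - m‖ ^ 2)]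
    refine (sum_sq_sub_blockMean_le_grad hn z Y c.dir).trans ?_
    refine mul_le_mul_of_nonneg_left ?_ (by positivity)
    exact sum_interior_le_sum_filter h0 hn z (fun x' x => ‖Y ⟨x', c.dir⟩ - Y ⟨x, c.dir⟩‖ ^ 2) fun _ _ => sq_nonneg _
  have hosc := norm_sq_bondAvgIter_sub_const_le hj0 h0j Y c m
  have hLd : (0 : ℝ) < ((P.L : ℝ) ^ j) ^ P.d := by have := P.L_pos; positivity
  calc ‖bondAvgIter j Y c - m‖ ^ 2
      ≤ 2 * (((P.L : ℝ) ^ j) ^ P.d)⁻¹ * (S + S) := hosc.trans (by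
          refine mul_le_mul_of_nonneg_left (add_le_add hA hB) (by positivity))
    _ ≤ 2 * (((P.L : ℝ) ^ j) ^ P.d)⁻¹ * (2 * ((N / 4) * ((n : ℝ) + 1) ^ 2 * E)) := by
          refine mul_le_mul_of_nonneg_left ?_ (by positivity)
          linarith
    _ = N * ((n : ℝ) + 1) ^ 2 * (((P.L : ℝ) ^ j) ^ P.d)⁻¹ * E := by ring

/-! ## §3 The per-level term of the gauge function (d = 3) and the monotonicity of the block energies along the nesting -/

/-- `√(L^j) = (√L)^j`. [folklore] -/
theorem sqrt_pow_eq (L : ℝ) (hL : 0 ≤ L) (j : ℕ) : Real.sqrt (L ^ j) = Real.sqrt L ^ j := by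
  rw [show L ^ j = (Real.sqrt L ^ j) ^ 2 by rw [← pow_mul, mul_comm, pow_mul, Real.sq_sqrt hL], Real.sqrt_sq (pow_nonneg (Real.sqrt_nonneg _) _)]

/-- **THE PER-LEVEL TERM, d = 3**: `‖L^j·combMean(Q_jY)(z)‖ ≤ (d+2)L·(√N·L·(√L)^j)·√E_{j+1}(z)`, `E_{j+1}(z)` the interior gradient energy of `Y` (all components) on the
fine `(j+1)`-block of `z` — centring (`Prop7CombMeanCentred.norm_combMean_le_osc` with the block means as direction constants) + §2.
[cite: Balaban1984PropagatorsI, (1.18) p.20; Balaban1985Averaging, (62) p.28] -/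
theorem norm_nsmul_combMean_le_energy (hd : P.d = 3) {j n : ℕ} (hj : j + 1 ≤ P.m + P.K) (hn : n + 1 = P.L ^ (j + 1)) (z : Site P (j + 1))
    (Y : PBond P 0 → Matrix (Fin N) (Fin N) ℂ) :
    ‖(P.L ^ j : ℕ) • combMean (bondAvgIter j Y) z‖
      ≤ ((P.d + 2) * P.L : ℕ) * (Real.sqrt N * P.L * Real.sqrt P.L ^ j) *
          Real.sqrt (∑ μ : Fin P.d, ∑ ν : Fin P.d, ∑ x ∈ univ.filter (fun x : Site P 0 => Site.proj (j + 1) (j + 1) x = z),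
            (if Site.proj (j + 1) (j + 1) (x.shift ν) = z then ‖Y ⟨x.shift ν, μ⟩ - Y ⟨x, μ⟩‖ ^ 2 else 0)) := by
  set E : Fin P.d → ℝ := fun μ => ∑ ν : Fin P.d, ∑ x ∈ univ.filter (fun x : Site P 0 => Site.proj (j + 1) (j + 1) x = z),
      (if Site.proj (j + 1) (j + 1) (x.shift ν) = z then ‖Y ⟨x.shift ν, μ⟩ - Y ⟨x, μ⟩‖ ^ 2 else 0) with hE
  set Etot : ℝ := ∑ μ : Fin P.d, E μ with hEtot
  have hEnn : ∀ μ, 0 ≤ E μ := fun μ => Finset.sum_nonneg fun ν _ => Finset.sum_nonneg fun x _ => by split_ifs <;> positivity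
  have hEle : ∀ μ, E μ ≤ Etot := fun μ => Finset.single_le_sum (f := E) (fun ν _ => hEnn ν) (Finset.mem_univ μ)
  have hEtot0 : 0 ≤ Etot := Finset.sum_nonneg fun μ _ => hEnn μ
  have hL0 : (0 : ℝ) < (P.L : ℝ) := by exact_mod_cast P.L_pos
  -- the direction constants: the block means
  set m : Fin P.d → Matrix (Fin N) (Fin N) ℂ := fun μ => (((n : ℝ) + 1) ^ P.d)⁻¹ • ∑ r' : Fin P.d → Fin (n + 1), Y ⟨bsite P 0 (j + 1) hn z r', μ⟩ with hm
  -- oscillation bound per bond of `B(z)`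
  set B : ℝ := N * ((n : ℝ) + 1) ^ 2 * (((P.L : ℝ) ^ j) ^ P.d)⁻¹ * Etot with hB
  have hB0 : 0 ≤ B := by positivity
  have hbond : ∀ b : PBond P j, blockOf b.src = z → blockOf b.tgt = z → ‖bondAvgIter j Y b - m b.dir‖ ≤ Real.sqrt B := by
    intro b hs ht
    have h2 := norm_sq_bondAvgIter_sub_blockMean_le hj hn z Y b hs ht
    have h3 : ‖bondAvgIter j Y b - m b.dir‖ ^ 2 ≤ B :=
      h2.trans (mul_le_mul_of_nonneg_left (hEle b.dir) (by positivity))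
    calc ‖bondAvgIter j Y b - m b.dir‖ = Real.sqrt (‖bondAvgIter j Y b - m b.dir‖ ^ 2) := (Real.sqrt_sq (norm_nonneg _)).symm
      _ ≤ Real.sqrt B := Real.sqrt_le_sqrt h3
  have hcm := norm_combMean_le_osc hj (bondAvgIter j Y) m z (Real.sqrt_nonneg B) hbond
  -- `L^j·√B = √N·L·(√L)^j·√Etot` (using `n + 1 = L^{j+1}`, `d = 3`)
  have hnR : ((n : ℝ) + 1) = (P.L : ℝ) ^ (j + 1) := by exact_mod_cast hn
  have hkey : ((P.L : ℝ) ^ j) * Real.sqrt B = Real.sqrt N * P.L * Real.sqrt P.L ^ j * Real.sqrt Etot := by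
    have hsq : ((P.L : ℝ) ^ j) ^ 2 * B = (N * (P.L : ℝ) ^ 2 * (P.L : ℝ) ^ j) * Etot := by
      rw [hB, hd, hnR]
      field_simp
      ring
    calc ((P.L : ℝ) ^ j) * Real.sqrt B = Real.sqrt (((P.L : ℝ) ^ j) ^ 2) * Real.sqrt B := by rw [Real.sqrt_sq (by positivity)]
      _ = Real.sqrt (((P.L : ℝ) ^ j) ^ 2 * B) := (Real.sqrt_mul (by positivity) B).symm
      _ = Real.sqrt ((N * (P.L : ℝ) ^ 2 * (P.L : ℝ) ^ j) * Etot) := by rw [hsq]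
      _ = Real.sqrt (N * (P.L : ℝ) ^ 2 * (P.L : ℝ) ^ j) * Real.sqrt Etot := Real.sqrt_mul (by positivity) Etot
      _ = Real.sqrt N * P.L * Real.sqrt P.L ^ j * Real.sqrt Etot := by
          rw [Real.sqrt_mul (by positivity), Real.sqrt_mul (Nat.cast_nonneg _), Real.sqrt_sq hL0.le, sqrt_pow_eq _ hL0.le]
  rw [← Nat.cast_smul_eq_nsmul ℝ, norm_smul, Real.norm_natCast]
  calc ((P.L ^ j : ℕ) : ℝ) * ‖combMean (bondAvgIter j Y) z‖
      ≤ ((P.L ^ j : ℕ) : ℝ) * ((((P.d + 2) * P.L : ℕ) : ℝ) * Real.sqrt B) := mul_le_mul_of_nonneg_left hcm (Nat.cast_nonneg _)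
    _ = (((P.d + 2) * P.L : ℕ) : ℝ) * (((P.L : ℝ) ^ j) * Real.sqrt B) := by push_cast; ring
    _ = (((P.d + 2) * P.L : ℕ) : ℝ) * (Real.sqrt N * P.L * Real.sqrt P.L ^ j) * Real.sqrt Etot := by rw [hkey]; ring

omit [NeZero N] in
/-- **MONOTONICITY OF THE BLOCK ENERGIES ALONG THE NESTING**: the interior gradient energy of the `j`-block of the centre `emb y` is at most that of the
`(j+1)`-block of `y` (the former's interior bonds are interior bonds of the latter). [folklore] -/
theorem energy_mono {j : ℕ} (hj : j + 1 ≤ P.m + P.K) (y : Site P (j + 1)) (Y : PBond P 0 → Matrix (Fin N) (Fin N) ℂ) :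
    (∑ μ : Fin P.d, ∑ ν : Fin P.d, ∑ x ∈ univ.filter (fun x : Site P 0 => Site.proj j j x = emb y),
        (if Site.proj j j (x.shift ν) = emb y then ‖Y ⟨x.shift ν, μ⟩ - Y ⟨x, μ⟩‖ ^ 2 else 0))
      ≤ ∑ μ : Fin P.d, ∑ ν : Fin P.d, ∑ x ∈ univ.filter (fun x : Site P 0 => Site.proj (j + 1) (j + 1) x = y),
        (if Site.proj (j + 1) (j + 1) (x.shift ν) = y then ‖Y ⟨x.shift ν, μ⟩ - Y ⟨x, μ⟩‖ ^ 2 else 0) := by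
  have h0j : P.sitesPerDir 0 = P.L ^ j * P.sitesPerDir j := sitesPerDir_zero_eq_pow_mul (Nat.le_of_succ_le hj)
  have h' : P.sitesPerDir j = P.L ^ 1 * P.sitesPerDir (j + 1) := sitesPerDir_succ_of_le hj
  have hup : ∀ x : Site P 0, Site.proj j j x = emb y → Site.proj (j + 1) (j + 1) x = y := fun x hx => by
    rw [proj_succ_of_proj h0j h' hx, Site.blockOf_emb hj]
  refine Finset.sum_le_sum fun μ _ => Finset.sum_le_sum fun ν _ => ?_
  rw [Finset.sum_filter, Finset.sum_filter]
  refine Finset.sum_le_sum fun x _ => ?_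
  by_cases hx : Site.proj j j x = emb y
  · rw [if_pos hx, if_pos (hup x hx)]
    by_cases hx' : Site.proj j j (x.shift ν) = emb y
    · rw [if_pos hx', if_pos (hup _ hx')]
    · rw [if_neg hx']
      split_ifs <;> positivity
  · rw [if_neg hx]
    split_ifs <;> positivity

/-! ## §4 The `(H¹)^*`-bound of the gauge function (d = 3): geometric summation along the nesting -/

/-- Propagation in the standing range (the version of `Prop7IterLinStructureRec.norm_iterLambda_sub_le` with the hypotheses restricted to the levels
`j + 1 ≤ K₀`). [folklore] -/
theorem norm_iterLambda_le_of_range {n₀ : Type*} [Fintype n₀] [DecidableEq n₀] (Y : PBond P 0 → Matrix n₀ n₀ ℂ)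
    (Λ : (k : ℕ) → Site P k → Matrix n₀ n₀ ℂ) (hΛ0 : ∀ y, Λ 0 y = 0)
    (hΛs : ∀ (k : ℕ) (y : Site P (k + 1)), Λ (k + 1) y = (P.L ^ k : ℕ) • combMean (bondAvgIter k Y) y + Λ k (emb y))
    (K₀ : ℕ) (a : ℕ → ℝ) (ha : ∀ j, 0 ≤ a j) (G : (k : ℕ) → Site P k → ℝ)
    (hG : ∀ (k : ℕ) (y : Site P (k + 1)), k + 1 ≤ K₀ → G k (emb y) ≤ G (k + 1) y)
    (hlev : ∀ (k : ℕ) (y : Site P (k + 1)), k + 1 ≤ K₀ → ‖(P.L ^ k : ℕ) • combMean (bondAvgIter k Y) y‖ ≤ a k * G (k + 1) y) :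
    ∀ (k : ℕ), k ≤ K₀ → ∀ (y : Site P k), ‖Λ k y‖ ≤ (∑ j ∈ Finset.range k, a j) * G k y := by
  intro k
  induction k with
  | zero => intro _ y; simp [hΛ0]
  | succ k ih =>
    intro hk y
    have hsum : 0 ≤ ∑ j ∈ Finset.range k, a j := Finset.sum_nonneg fun j _ => ha j
    rw [hΛs, Finset.sum_range_succ]
    calc ‖(P.L ^ k : ℕ) • combMean (bondAvgIter k Y) y + Λ k (emb y)‖
        ≤ ‖(P.L ^ k : ℕ) • combMean (bondAvgIter k Y) y‖ + ‖Λ k (emb y)‖ := norm_add_le _ _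
      _ ≤ a k * G (k + 1) y + (∑ j ∈ Finset.range k, a j) * G k (emb y) := add_le_add (hlev k y hk) (ih (Nat.le_of_succ_le hk) (emb y))
      _ ≤ a k * G (k + 1) y + (∑ j ∈ Finset.range k, a j) * G (k + 1) y := by
          have := mul_le_mul_of_nonneg_left (hG k y hk) hsum
          linarith
      _ = (∑ j ∈ Finset.range k, a j + a k) * G (k + 1) y := by ring

/-- **THE `(H¹)^*`-BOUND OF THE STRUCTURE THEOREM'S GAUGE FUNCTION, d = 3**: for every recursion family `Λ` (`Λ_0 = 0`,
`Λ_{k+1}(y) = L^k·combMean(Q_kY)(y) + Λ_k(emb y)`; in particular the one of `Prop7IterLinStructureRec.exists_iterLambda_eq`, for which `Q^{(k)}Y = L^kQ_kY − ∇Λ_kY`)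
and every `k ≤ m + K`: `‖Λ_k(Y)(y)‖ ≤ (d+2)L·√N·L·((√L)^k/(√L − 1))·√E_k(y)` — the constant grows like `L^{k/2}`, i.e. `‖Λ_k‖² ≲ L^k·E_k`: the `(H¹)^*`-norm of the
point-source part of the k-fold averaging functional is `O(√ℓ)`, uniformly in `k` (GEOMETRIC sum over the levels). [cite: Balaban1984PropagatorsI, (1.18)-(1.20) pp.19-20] -/
theorem norm_iterLambda_le_energy (hd : P.d = 3) (Y : PBond P 0 → Matrix (Fin N) (Fin N) ℂ)
    (Λ : (k : ℕ) → Site P k → Matrix (Fin N) (Fin N) ℂ) (hΛ0 : ∀ y, Λ 0 y = 0)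
    (hΛs : ∀ (k : ℕ) (y : Site P (k + 1)), Λ (k + 1) y = (P.L ^ k : ℕ) • combMean (bondAvgIter k Y) y + Λ k (emb y)) :
    ∀ (k : ℕ), k ≤ P.m + P.K → ∀ (y : Site P k),
      ‖Λ k y‖ ≤ ((P.d + 2) * P.L : ℕ) * (Real.sqrt N * P.L) * (Real.sqrt P.L ^ k / (Real.sqrt P.L - 1)) *
        Real.sqrt (∑ μ : Fin P.d, ∑ ν : Fin P.d, ∑ x ∈ univ.filter (fun x : Site P 0 => Site.proj k k x = y),
          (if Site.proj k k (x.shift ν) = y then ‖Y ⟨x.shift ν, μ⟩ - Y ⟨x, μ⟩‖ ^ 2 else 0)) := by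
  intro k hk y
  have hL1 : (1 : ℝ) < (P.L : ℝ) := by exact_mod_cast P.hL.2
  set G : (k : ℕ) → Site P k → ℝ := fun k y => Real.sqrt (∑ μ : Fin P.d, ∑ ν : Fin P.d, ∑ x ∈ univ.filter (fun x : Site P 0 => Site.proj k k x = y),
      (if Site.proj k k (x.shift ν) = y then ‖Y ⟨x.shift ν, μ⟩ - Y ⟨x, μ⟩‖ ^ 2 else 0)) with hGdef
  set a : ℕ → ℝ := fun j => ((P.d + 2) * P.L : ℕ) * (Real.sqrt N * P.L * Real.sqrt P.L ^ j) with hadef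
  have ha : ∀ j, 0 ≤ a j := fun j => by positivity
  have hG : ∀ (j : ℕ) (y : Site P (j + 1)), j + 1 ≤ P.m + P.K → G j (emb y) ≤ G (j + 1) y :=
    fun j y hj => Real.sqrt_le_sqrt (energy_mono hj y Y)
  have hlev : ∀ (j : ℕ) (y : Site P (j + 1)), j + 1 ≤ P.m + P.K → ‖(P.L ^ j : ℕ) • combMean (bondAvgIter j Y) y‖ ≤ a j * G (j + 1) y := by
    intro j y hj
    obtain ⟨n, hn⟩ : ∃ n : ℕ, n + 1 = P.L ^ (j + 1) := ⟨P.L ^ (j + 1) - 1, Nat.sub_add_cancel (Nat.one_le_pow _ _ P.L_pos)⟩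
    exact norm_nsmul_combMean_le_energy hd hj hn y Y
  have hmain := norm_iterLambda_le_of_range Y Λ hΛ0 hΛs (P.m + P.K) a ha G hG hlev k hk y
  refine hmain.trans ?_
  -- `Σ_{j<k} a_j = (d+2)L·√N·L·Σ_{j<k}(√L)^j ≤ (d+2)L·√N·L·(√L)^k/(√L − 1)`
  have hgeom := geom_sum_sqrt_le hL1 k
  have hsum : ∑ j ∈ Finset.range k, a j = ((P.d + 2) * P.L : ℕ) * (Real.sqrt N * P.L) * ∑ j ∈ Finset.range k, Real.sqrt P.L ^ j := by
    rw [hadef, Finset.mul_sum]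
    exact Finset.sum_congr rfl fun j _ => by ring
  rw [hsum]
  have hG0 : 0 ≤ G k y := Real.sqrt_nonneg _
  exact mul_le_mul_of_nonneg_right (mul_le_mul_of_nonneg_left hgeom (by positivity)) hG0

/-- **SQUARED FORM**: `‖Λ_k(Y)(y)‖² ≤ ((d+2)L)²·N·L²·(L^k/(√L − 1)²)·E_k(y)` (`d = 3`, `k ≤ m + K`) — the bound the P-lin-flat assembly (N7) sums over the k-blocks:
`Σ_y ‖Λ_k(y)‖² ≤ c₂·L^k·Σ_y E_k(y) ≤ c₂·ℓ·‖∇Y‖²`. [cite: Balaban1984PropagatorsI, (1.18)-(1.20) pp.19-20] -/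
theorem norm_sq_iterLambda_le (hd : P.d = 3) (Y : PBond P 0 → Matrix (Fin N) (Fin N) ℂ)
    (Λ : (k : ℕ) → Site P k → Matrix (Fin N) (Fin N) ℂ) (hΛ0 : ∀ y, Λ 0 y = 0)
    (hΛs : ∀ (k : ℕ) (y : Site P (k + 1)), Λ (k + 1) y = (P.L ^ k : ℕ) • combMean (bondAvgIter k Y) y + Λ k (emb y))
    {k : ℕ} (hk : k ≤ P.m + P.K) (y : Site P k) :
    ‖Λ k y‖ ^ 2 ≤ ((((P.d + 2) * P.L : ℕ) : ℝ) ^ 2 * N * (P.L : ℝ) ^ 2 * ((P.L : ℝ) ^ k / (Real.sqrt P.L - 1) ^ 2)) *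
        ∑ μ : Fin P.d, ∑ ν : Fin P.d, ∑ x ∈ univ.filter (fun x : Site P 0 => Site.proj k k x = y),
          (if Site.proj k k (x.shift ν) = y then ‖Y ⟨x.shift ν, μ⟩ - Y ⟨x, μ⟩‖ ^ 2 else 0) := by
  have h := norm_iterLambda_le_energy hd Y Λ hΛ0 hΛs k hk y
  set E : ℝ := ∑ μ : Fin P.d, ∑ ν : Fin P.d, ∑ x ∈ univ.filter (fun x : Site P 0 => Site.proj k k x = y),
      (if Site.proj k k (x.shift ν) = y then ‖Y ⟨x.shift ν, μ⟩ - Y ⟨x, μ⟩‖ ^ 2 else 0) with hE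
  have hE0 : 0 ≤ E := Finset.sum_nonneg fun μ _ => Finset.sum_nonneg fun ν _ => Finset.sum_nonneg fun x _ => by split_ifs <;> positivity
  have hL0 : (0 : ℝ) ≤ (P.L : ℝ) := Nat.cast_nonneg _
  have hrhs0 : 0 ≤ ((P.d + 2) * P.L : ℕ) * (Real.sqrt N * P.L) * (Real.sqrt P.L ^ k / (Real.sqrt P.L - 1)) * Real.sqrt E := by
    have hs : 0 < Real.sqrt P.L - 1 := by
      have hL1 : (1 : ℝ) < (P.L : ℝ) := by exact_mod_cast P.hL.2
      rw [sub_pos, show (1 : ℝ) = Real.sqrt 1 from Real.sqrt_one.symm]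
      exact Real.sqrt_lt_sqrt zero_le_one hL1
    positivity
  calc ‖Λ k y‖ ^ 2 ≤ (((P.d + 2) * P.L : ℕ) * (Real.sqrt N * P.L) * (Real.sqrt P.L ^ k / (Real.sqrt P.L - 1)) * Real.sqrt E) ^ 2 :=
        pow_le_pow_left₀ (norm_nonneg _) h 2
    _ = ((((P.d + 2) * P.L : ℕ) : ℝ) ^ 2 * N * (P.L : ℝ) ^ 2 * ((P.L : ℝ) ^ k / (Real.sqrt P.L - 1) ^ 2)) * E := by
        rw [mul_pow, mul_pow, mul_pow, mul_pow, div_pow, Real.sq_sqrt hE0, Real.sq_sqrt (Nat.cast_nonneg _), ← pow_mul,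
          show Real.sqrt (P.L : ℝ) ^ (k * 2) = (P.L : ℝ) ^ k by rw [mul_comm, pow_mul, Real.sq_sqrt hL0]]
        ring

end Summit.QuantumFields.YangMills.Theorems.Prop7IterLambdaBound

end
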